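/-
COR-CM (cell pub-hodgecm2, stage 2 of the Hodge ladder) — count-neutral KERNEL COMBINATORICS «spectator doubling G = H × ⟨x⟩ (x a CENTRAL involution
outside the index-two subgroup H ∋ c), part IV: the block counts — the diagonal blocks are the blocks of (H, c), G acts freely on the neighbour types,
#{neighbour blocks} · 4 = 2^{|H|/2}» (seat prover-pub-hodgecm2-b23-g47-0, binder prover b23, gen 47; claim «SPECTATOR DOUBLING», HOME/INBOX.md
l.21993).  Theorems only (no definition), on top of part I `Census/SpectatorSquares` and gen 41ʼs `Census/IndexTwoDescentDictionary` BY NAME; no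
`decide`, no certificate, no named fact, no `sorry`; `Interfaces.lean` (C1), every E term, B01, `Transposition/*`, `PortJoin/*`, `D2Bridge/*` untouched.
HONEST FRAMING: `HC_CM` is NOT proved, here or anywhere in the tree; nothing here is a period, a count of record or a headline.
T5: n/a-class (hypothesis binders: `c * c = 1`, `c ≠ 1`, `c` central, `c ∈ H`, `H.index = 2`, `x ∉ H`, `x * x = 1`, `x` central, `|H| ≠ 2`);
checker: self.
-/
import Summits.HodgeConjecture.CorCM.Census.SpectatorSquares

/-!
# Spectator doubling `G = H × ⟨x⟩`, IV: diagonal blocks = blocks of `H`, free action on neighbour types, `#{neighbour blocks} · 4 = 2^{|H|/2}`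

THE SETTING of parts I–III: `c ≠ 1` a central involution of the finite group `G`, `H ∋ c` of index two, `x ∉ H` CENTRAL with `x · x = 1`.
The distance `D(Ψ) = wt (res₁ Ψ) (res₀ Ψ)` is a block invariant (gen 46ʼs `wt_res_rt`); blocks are DIAGONAL (`D = 0`), NEIGHBOUR (`D = 1`) or
FAR (`D ≥ 2`).

* §1 Base change of glued types: `(glue a b)·h⁻¹ = glue (a·h⁻¹) (b·h⁻¹)`, `(glue a b)·x = glue b a`.
* §2 **The diagonal blocks of `(G, c)` are the blocks of `(H, c)`** (`card_diagonal_blocks`): `b ↦` the block of `res₀` of a representative is a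
  bijection `{b | D = 0} ≃ Block (H, c)`.
* §3 **`G` acts freely on the neighbour types** (`eq_one_of_rt_eq_of_nbr`, for `|H| ≠ 2`): a base change fixing a type `(a, a^{(t)})` along `h ∈ H`
  fixes `a` and the place of `t`, so `h ∈ {1, c}` and `h ≠ c`; along `x h` it would give `a·h⁻¹ = a^{(t)}` and `a^{(t)}·h⁻¹ = a`, forcing again
  `h ∈ {1, c}`, and then `a^{(t)} ∈ {a, ā}` — impossible when `H` has at least two places.
* §4 **THE COUNTS** (`card_nbr_types`, `card_nbr_blocks_mul_card`, `card_nbr_blocks_mul_four`): the neighbour types are the pairs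
  `(a, a^{(t)})`, `2^{|H|/2} · (|H|/2)` of them; they form `#{neighbour blocks} · |G|` types; hence **`#{neighbour blocks} · 4 = 2^{|H|/2}`**, i.e.
  `#{neighbour blocks} = 2^{n_H − 2}` with `n_H = |H|/2 ≥ 2` the number of places of `H`, and `β(G, c) = β(H, c) + 2^{n_H − 2} + #{far blocks}`
  (`card_block_spectator`).  With parts II–III: `β(G,c) − 2 + d₂(H/𝒦_H) ≤ μ(G, c) ≤ μ(H, c) + #{far blocks} + n_H · 2^{n_H − 2}`.

## References
* [Pohlmann1968] H. Pohlmann, Algebraic cycles on abelian varieties of complex multiplication type, Ann. of Math. 88 (1968), Thm 1.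
* [Milne1999] J. S. Milne, Lefschetz motives and the Tate conjecture, Compositio Math. 117 (1999), Prop. 2.1, p. 54.
-/

namespace Summit.HodgeConjecture.CorCM.Census.Spectator

open Finset
open Summit.HodgeConjecture.CorCM.Prior.AllgGroup.RfwfAllgGroup
open Summit.HodgeConjecture.CorCM.Census.BlockParity
open Summit.HodgeConjecture.CorCM.Census.Coinvariant
open Summit.HodgeConjecture.CorCM.Census.ComplementFaces
open Summit.HodgeConjecture.CorCM.Census.IndexTwoDescent

noncomputable section

variable {G : Type*} [Group G] [Fintype G] [DecidableEq G] {c : G}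
variable {H : Subgroup G} [DecidablePred (· ∈ H)]

/-! ## §1 Base change of glued types -/

/-- **Base change of a glued type along `h ∈ H` is diagonal**: `(glue a b)·h⁻¹ = glue (a·h⁻¹) (b·h⁻¹)`. [folklore] -/
theorem rt_coe_glue (hcH : c ∈ H) (hcen : ∀ g : G, g * c = c * g) (hH : H.index = 2) {x : G} (hx : x ∉ H) (h : H)
    (a b : CMF H ⟨c, hcH⟩) :
    rt c (h : G) (glue hcH hcen hH hx a b) = glue hcH hcen hH hx (rt (⟨c, hcH⟩ : H) h a) (rt (⟨c, hcH⟩ : H) h b) := by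
  apply ext_of_res hcH hcen hH hx
  · rw [res₀_rt_coe, res₀_glue, res₀_glue]
  · rw [res₁_rt_coe, res₁_glue, res₁_glue]

/-- **Base change of a glued type along the central involution `x` swaps the parts**: `(glue a b)·x = glue b a`. [folklore] -/
theorem rt_x_glue (hcH : c ∈ H) (hcen : ∀ g : G, g * c = c * g) (hH : H.index = 2) {x : G} (hx : x ∉ H) (hxx : x * x = 1)
    (hxc : ∀ g : G, g * x = x * g) (a b : CMF H ⟨c, hcH⟩) :
    rt c x (glue hcH hcen hH hx a b) = glue hcH hcen hH hx b a := by
  apply ext_of_res hcH hcen hH hx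
  · rw [res₀_rt_x hcH hcen hxc, res₁_glue, res₀_glue]
  · rw [res₁_rt_x hcH hcen hxx hxc, res₀_glue, res₁_glue]

/-- The parts of a base change: along `Q ∈ H ∪ xH` the `0`-part of `Ψ·Q⁻¹` is a base change of `res₀ Ψ` or of `res₁ Ψ`. [folklore] -/
theorem exists_res₀_rt (hcH : c ∈ H) (hcen : ∀ g : G, g * c = c * g) (hH : H.index = 2) {x : G} (hx : x ∉ H) (hxx : x * x = 1)
    (hxc : ∀ g : G, g * x = x * g) (Q : G) (Ψ : CMF G c) :
    ∃ h : H, (res₀ hcH (rt c Q Ψ) = rt (⟨c, hcH⟩ : H) h (res₀ hcH Ψ) ∧ res₁ hcH hcen x (rt c Q Ψ) = rt (⟨c, hcH⟩ : H) h (res₁ hcH hcen x Ψ)) ∨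
      (res₀ hcH (rt c Q Ψ) = rt (⟨c, hcH⟩ : H) h (res₁ hcH hcen x Ψ) ∧ res₁ hcH hcen x (rt c Q Ψ) = rt (⟨c, hcH⟩ : H) h (res₀ hcH Ψ)) := by
  by_cases hQ : Q ∈ H
  · exact ⟨⟨Q, hQ⟩, Or.inl ⟨res₀_rt_coe hcH ⟨Q, hQ⟩ Ψ, res₁_rt_coe hcH hcen x ⟨Q, hQ⟩ Ψ⟩⟩
  · obtain ⟨h, rfl⟩ := exists_eq_mul_of_not_mem hH hx hQ
    refine ⟨h, Or.inr ⟨?_, ?_⟩⟩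
    · rw [rt_mul, res₀_rt_x hcH hcen hxc, res₁_rt_coe]
    · rw [rt_mul, res₁_rt_x hcH hcen hxx hxc, res₀_rt_coe]

/-! ## §2 The diagonal blocks are the blocks of `(H, c)` -/

/-- **`#{diagonal blocks of (G, c)} = β(H, c)`**: the map `b ↦ blk (res₀ Ψ_b)` (any `Ψ_b ∈ b`) is a bijection from the blocks of distance `0`
onto the blocks of `(H, c)`, with inverse `b' ↦ blk (glue a a)` (`a ∈ b'`). [folklore] -/
theorem card_diagonal_blocks (hcH : c ∈ H) (hcen : ∀ g : G, g * c = c * g) (hc2 : c * c = 1) (hH : H.index = 2) {x : G} (hx : x ∉ H)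
    (hxx : x * x = 1) (hxc : ∀ g : G, g * x = x * g) :
    Fintype.card {b : Block c // wt (⟨c, hcH⟩ : H) (res₁ hcH hcen x b.out) (res₀ hcH b.out) = 0} =
      Fintype.card (Block (⟨c, hcH⟩ : H)) := by
  classical
  set c₁ : H := ⟨c, hcH⟩ with hc₁
  -- forward and backward maps
  let f : {b : Block c // wt c₁ (res₁ hcH hcen x b.out) (res₀ hcH b.out) = 0} → Block c₁ := fun b => blk c₁ (res₀ hcH b.1.out)
  let g : Block c₁ → {b : Block c // wt c₁ (res₁ hcH hcen x b.out) (res₀ hcH b.out) = 0} := fun b' =>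
    ⟨blk c (glue hcH hcen hH hx b'.out b'.out), by
      -- the representative of the block of a diagonal type is diagonal
      have hd : res₁ hcH hcen x (glue hcH hcen hH hx b'.out b'.out) = res₀ hcH (glue hcH hcen hH hx b'.out b'.out) := by
        rw [res₀_glue, res₁_glue]
      obtain ⟨Q, hQ⟩ := exists_rt_eq_of_blk_eq c
        (show blk c (glue hcH hcen hH hx b'.out b'.out) = blk c (blk c (glue hcH hcen hH hx b'.out b'.out)).out from
          (Quotient.out_eq _).symm)
      rw [← hQ, diagonal_rt hcH hcen hc2 hH hx hxx Q hd, ComplementFaces.wt_self]⟩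
  refine Fintype.card_congr { toFun := f, invFun := g, left_inv := ?_, right_inv := ?_ }
  · -- g (f b) = b
    rintro ⟨b, hb⟩
    apply Subtype.ext
    show blk c (glue hcH hcen hH hx (blk c₁ (res₀ hcH b.out)).out (blk c₁ (res₀ hcH b.out)).out) = b
    obtain ⟨q, hq⟩ := exists_rt_eq_of_blk_eq c₁
      (show blk c₁ (res₀ hcH b.out) = blk c₁ (blk c₁ (res₀ hcH b.out)).out from (Quotient.out_eq _).symm)
    have hdiag : res₁ hcH hcen x b.out = res₀ hcH b.out := (eq_of_wt_eq_zero c₁ hb).symm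
    rw [← hq, ← rt_coe_glue hcH hcen hH hx, blk_rt]
    conv_lhs => rw [show glue hcH hcen hH hx (res₀ hcH b.out) (res₀ hcH b.out) = b.out by
      rw [← glue_res hcH hcen hH hx b.out, hdiag, res₀_glue]]
    exact Quotient.out_eq b
  · -- f (g b') = b'
    intro b'
    show blk c₁ (res₀ hcH (blk c (glue hcH hcen hH hx b'.out b'.out)).out) = b'
    obtain ⟨Q, hQ⟩ := exists_rt_eq_of_blk_eq c
      (show blk c (glue hcH hcen hH hx b'.out b'.out) = blk c (blk c (glue hcH hcen hH hx b'.out b'.out)).out from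
        (Quotient.out_eq _).symm)
    rw [← hQ]
    obtain ⟨h, hh⟩ := exists_res₀_rt hcH hcen hH hx hxx hxc Q (glue hcH hcen hH hx b'.out b'.out)
    rcases hh with ⟨h0, -⟩ | ⟨h0, -⟩
    · rw [h0, res₀_glue, blk_rt]; exact Quotient.out_eq b'
    · rw [h0, res₁_glue, blk_rt]; exact Quotient.out_eq b'

/-! ## §3 `G` acts freely on the neighbour types -/

section Flips

variable {K : Type*} [Group K] [Fintype K] [DecidableEq K] (c' : K)

/-- **Flips at different places give different types**: `a^{(s)} = a^{(t)}` forces `s ∈ {t, c t}`. [folklore] -/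
theorem mem_orb_of_oflipCM_eq (hc2' : c' * c' = 1) (a : CMF K c') {s t : K}
    (h : oflipCM c' hc2' s a = oflipCM c' hc2' t a) : s ∈ orb c' t := by
  by_contra hst
  -- the element of `a` at the place of `s`
  have hu : ∃ u ∈ a.1, u ∈ orb c' s := by
    by_cases hs : s ∈ a.1
    · exact ⟨s, hs, (mem_orb c').mpr (Or.inl rfl)⟩
    · exact ⟨c' * s, by by_contra h'; exact hs ((a.2 s).mpr h'), (mem_orb c').mpr (Or.inr rfl)⟩
  obtain ⟨u, hua, hus⟩ := hu
  have hut : u ∉ orb c' t := by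
    intro hut'
    apply hst
    rw [mem_orb] at hus hut'
    rw [mem_orb]
    rcases hus with rfl | rfl <;> rcases hut' with h1 | h1
    · exact Or.inl h1
    · exact Or.inr h1
    · exact Or.inr (by rw [← h1, ← mul_assoc, hc2', one_mul])
    · exact Or.inl (mul_left_cancel h1)
  have h1 : u ∉ (oflipCM c' hc2' s a).1 := by
    change u ∉ oflip c' s a.1; rw [oflip, mem_symmDiff, not_or, not_and, not_and, not_not, not_not]
    exact ⟨fun _ => hus, fun _ => hua⟩
  have h2 : u ∈ (oflipCM c' hc2' t a).1 := by
    change u ∈ oflip c' t a.1; rw [oflip, mem_symmDiff]; exact Or.inl ⟨hua, hut⟩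
  rw [h] at h1
  exact h1 h2

/-- A flip changes the type. [folklore] -/
theorem oflipCM_ne_self (hc2' : c' * c' = 1) (a : CMF K c') (t : K) : oflipCM c' hc2' t a ≠ a := by
  intro h
  have h1 := wt_oflipCM_eq_one c' hc2' a t
  rw [h, ComplementFaces.wt_self] at h1
  exact absurd h1 (by norm_num)

/-- The conjugate type differs from the type. [folklore] -/
theorem rt_self_ne (hc2' : c' * c' = 1) (hcen' : ∀ k : K, k * c' = c' * k) (a : CMF K c') : rt c' c' a ≠ a := by
  intro h
  have h1 : wt c' a (rt c' c' a) = a.1.card := by rw [wt_rt_self c' hcen', ComplementFaces.wt_self, Nat.sub_zero]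
  rw [h, ComplementFaces.wt_self] at h1
  have h3 := two_mul_card_val c' hc2' a
  have h4 : 0 < Fintype.card K := Fintype.card_pos
  omega

/-- The conjugate type `a·c` is a flip `a^{(t)}` only if `H` has ONE place (`|K| = 2`). [folklore] -/
theorem rt_self_ne_oflipCM (hc2' : c' * c' = 1) (hcen' : ∀ k : K, k * c' = c' * k) (hK : Fintype.card K ≠ 2) (a : CMF K c') (t : K) :
    rt c' c' a ≠ oflipCM c' hc2' t a := by
  intro h
  have h1 : wt c' a (rt c' c' a) = a.1.card := by rw [wt_rt_self c' hcen', ComplementFaces.wt_self, Nat.sub_zero]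
  have h2 : wt c' a (oflipCM c' hc2' t a) = 1 := by rw [wt_comm c' hc2']; exact wt_oflipCM_eq_one c' hc2' a t
  rw [h, h2] at h1
  have h3 := two_mul_card_val c' hc2' a
  omega

end Flips

/-- **`G` ACTS FREELY ON THE NEIGHBOUR TYPES** (`|H| ≠ 2`): if `res₁ Θ = (res₀ Θ)^{(t)}` and `Θ·Q⁻¹ = Θ` then `Q = 1`. [folklore] -/
theorem eq_one_of_rt_eq_of_nbr (hcH : c ∈ H) (hcen : ∀ g : G, g * c = c * g) (hc2 : c * c = 1) (hH : H.index = 2)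
    {x : G} (hx : x ∉ H) (hxx : x * x = 1) (hxc : ∀ g : G, g * x = x * g) (hH2 : Fintype.card H ≠ 2)
    {Θ : CMF G c} {t : H} (hΘ : res₁ hcH hcen x Θ = oflipCM (⟨c, hcH⟩ : H) (csub_mul_csub hcH hc2) t (res₀ hcH Θ))
    {Q : G} (hQ : rt c Q Θ = Θ) : Q = 1 := by
  have hc2' := csub_mul_csub hcH hc2
  have hcen' : ∀ k : H, k * (⟨c, hcH⟩ : H) = ⟨c, hcH⟩ * k := fun k => csub_comm hcH hcen k
  -- `h ∈ {1, c}` as soon as `a^{(t h⁻¹)} = a^{(t)}`-type coincidences hold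
  have key : ∀ h : H, oflipCM (⟨c, hcH⟩ : H) hc2' (t * h⁻¹) (res₀ hcH Θ) = oflipCM (⟨c, hcH⟩ : H) hc2' t (res₀ hcH Θ) → h = 1 ∨ h = (⟨c, hcH⟩ : H) := by
    intro h hh
    have hm := mem_orb_of_oflipCM_eq (⟨c, hcH⟩ : H) hc2' (res₀ hcH Θ) hh
    rw [mem_orb] at hm
    rcases hm with hm | hm
    · left; have := mul_left_cancel (hm.trans (mul_one (t : H)).symm); exact inv_eq_one.mp this
    · right
      have e : h⁻¹ = t⁻¹ * (⟨c, hcH⟩ : H) * t := by rw [mul_assoc, ← hm, inv_mul_cancel_left]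
      rw [mul_assoc, ← hcen' t, inv_mul_cancel_left] at e
      rw [← inv_inv h, e]
      exact Subtype.ext (by show c⁻¹ = c; exact inv_eq_of_mul_eq_one_right hc2)
  by_cases hQH : Q ∈ H
  · obtain ⟨h, rfl⟩ : ∃ h : H, (h : G) = Q := ⟨⟨Q, hQH⟩, rfl⟩
    have h0 : rt (⟨c, hcH⟩ : H) h (res₀ hcH Θ) = res₀ hcH Θ := by rw [← res₀_rt_coe, hQ]
    have h1 : rt (⟨c, hcH⟩ : H) h (res₁ hcH hcen x Θ) = res₁ hcH hcen x Θ := by rw [← res₁_rt_coe, hQ]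
    rw [hΘ, rt_oflipCM _ hc2', h0] at h1
    rcases key h h1 with rfl | rfl
    · rfl
    · exact absurd h0 (rt_self_ne (⟨c, hcH⟩ : H) hc2' hcen' (res₀ hcH Θ))
  · obtain ⟨h, rfl⟩ := exists_eq_mul_of_not_mem hH hx hQH
    have h0 : res₀ hcH (rt c (x * (h : G)) Θ) = rt (⟨c, hcH⟩ : H) h (res₁ hcH hcen x Θ) := by rw [rt_mul, res₀_rt_x hcH hcen hxc, res₁_rt_coe]
    have h1 : res₁ hcH hcen x (rt c (x * (h : G)) Θ) = rt (⟨c, hcH⟩ : H) h (res₀ hcH Θ) := by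
      rw [rt_mul, res₁_rt_x hcH hcen hxx hxc, res₀_rt_coe]
    rw [hQ] at h0 h1
    -- `a = (a^{(t)})·h⁻¹ = (a·h⁻¹)^{(t h⁻¹)}` and `a^{(t)} = a·h⁻¹`
    rw [hΘ, rt_oflipCM _ hc2'] at h0
    rw [hΘ] at h1
    rw [← h1] at h0
    -- `h0 : a = (a^{(t)})^{(t h⁻¹)}`, so `a^{(t h⁻¹)} = a^{(t)}`
    have h2 : oflipCM (⟨c, hcH⟩ : H) hc2' (t * h⁻¹) (res₀ hcH Θ) = oflipCM (⟨c, hcH⟩ : H) hc2' t (res₀ hcH Θ) := by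
      have := congrArg (oflipCM (⟨c, hcH⟩ : H) hc2' (t * h⁻¹)) h0
      rw [oflipCM_oflipCM_self] at this
      exact this
    rcases key h h2 with rfl | rfl
    · rw [rt_one] at h1
      exact absurd h1 (oflipCM_ne_self (⟨c, hcH⟩ : H) hc2' (res₀ hcH Θ) t)
    · exact absurd h1.symm (rt_self_ne_oflipCM (⟨c, hcH⟩ : H) hc2' hcen' hH2 (res₀ hcH Θ) t)

/-! ## §4 The counts -/

/-- **The neighbour types are the pairs `(a, a^{(t)})`**: `#{Θ | D(Θ) = 1} = #CMF(H, c) · (|H|/2)`. [folklore] -/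
theorem card_nbr_types (hcH : c ∈ H) (hcen : ∀ g : G, g * c = c * g) (hc2 : c * c = 1) (hH : H.index = 2) {x : G} (hx : x ∉ H) :
    Nat.card {Θ : CMF G c // wt (⟨c, hcH⟩ : H) (res₁ hcH hcen x Θ) (res₀ hcH Θ) = 1} =
      Nat.card (CMF H ⟨c, hcH⟩) * (Fintype.card H / 2) := by
  classical
  have hc2' := csub_mul_csub hcH hc2
  set c₁ : H := ⟨c, hcH⟩ with hc₁
  -- types of `(H, c)` at weight one from `a` are the flips `a^{(t)}`, `t ∈ a`
  have hfib : ∀ a : CMF H c₁, Nat.card {b : CMF H c₁ // wt c₁ b a = 1} = Fintype.card H / 2 := by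
    intro a
    have hbij : Function.Bijective (fun t : {t : H // t ∈ a.1} =>
        (⟨oflipCM c₁ hc2' (t : H) a, wt_oflipCM_eq_one c₁ hc2' a t⟩ : {b : CMF H c₁ // wt c₁ b a = 1})) := by
      constructor
      · rintro ⟨t, ht⟩ ⟨t', ht'⟩ h
        have h' : oflipCM c₁ hc2' t a = oflipCM c₁ hc2' t' a := congrArg Subtype.val h
        have hm := mem_orb_of_oflipCM_eq c₁ hc2' a h'
        rw [mem_orb] at hm
        rcases hm with hm | hm
        · exact Subtype.ext hm
        · exact absurd ht (by rw [hm]; exact (a.2 t').mp ht')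
      · rintro ⟨b, hb⟩
        rw [wt_comm c₁ hc2'] at hb
        obtain ⟨d, hd, rfl⟩ := exists_eq_oflipCM_of_wt_eq_one c₁ hc2' hb
        exact ⟨⟨d, hd⟩, rfl⟩
    rw [← Nat.card_congr (Equiv.ofBijective _ hbij), Nat.card_eq_fintype_card, Fintype.card_coe]
    have := two_mul_card_val c₁ hc2' a
    omega
  -- `{Θ | D = 1} ≃ Σ a, {b | wt b a = 1}`
  have e1 : {Θ : CMF G c // wt c₁ (res₁ hcH hcen x Θ) (res₀ hcH Θ) = 1} ≃
      {p : CMF H c₁ × CMF H c₁ // wt c₁ p.2 p.1 = 1} :=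
    (typePairEquiv hcH hcen hH hx).subtypeEquiv fun Θ => by rw [typePairEquiv_apply]
  have e2 := Equiv.subtypeProdEquivSigmaSubtype fun a b : CMF H c₁ => wt c₁ b a = 1
  haveI : Fintype (CMF H c₁) := Fintype.ofFinite _
  rw [Nat.card_congr (e1.trans e2), Nat.card_sigma, Finset.sum_congr rfl fun a _ => hfib a, Finset.sum_const, smul_eq_mul,
    Finset.card_univ, Nat.card_eq_fintype_card]

/-- **The neighbour types form `#{neighbour blocks} · |G|` types** (`|H| ≠ 2`): `(b, Q) ↦ Ψ_b·Q⁻¹` is a bijection onto the types of distance `1`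
by the free action. [folklore] -/
theorem card_nbr_blocks_mul_card (hcH : c ∈ H) (hcen : ∀ g : G, g * c = c * g) (hc2 : c * c = 1) (hH : H.index = 2)
    {x : G} (hx : x ∉ H) (hxx : x * x = 1) (hxc : ∀ g : G, g * x = x * g) (hH2 : Fintype.card H ≠ 2) :
    Fintype.card {b : Block c // wt (⟨c, hcH⟩ : H) (res₁ hcH hcen x b.out) (res₀ hcH b.out) = 1} * Fintype.card G =
      Nat.card {Θ : CMF G c // wt (⟨c, hcH⟩ : H) (res₁ hcH hcen x Θ) (res₀ hcH Θ) = 1} := by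
  classical
  have hc2' := csub_mul_csub hcH hc2
  set c₁ : H := ⟨c, hcH⟩ with hc₁
  have hbij : Function.Bijective (fun p : {b : Block c // wt c₁ (res₁ hcH hcen x b.out) (res₀ hcH b.out) = 1} × G =>
      (⟨rt c p.2 p.1.1.out, by rw [wt_res_rt hcH hcen hc2 hH hx hxx]; exact p.1.2⟩ :
        {Θ : CMF G c // wt c₁ (res₁ hcH hcen x Θ) (res₀ hcH Θ) = 1})) := by
    constructor
    · rintro ⟨⟨b, hb⟩, Q⟩ ⟨⟨b', hb'⟩, Q'⟩ h
      have h' : rt c Q b.out = rt c Q' b'.out := congrArg Subtype.val h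
      have hbb : b = b' := by
        have := congrArg (blk c) h'
        rw [blk_rt, blk_rt] at this
        have hb1 : blk c b.out = b := Quotient.out_eq b
        have hb2 : blk c b'.out = b' := Quotient.out_eq b'
        rw [hb1, hb2] at this
        exact this
      subst hbb
      -- free action: `Q'⁻¹ Q` fixes the neighbour type `b.out`
      obtain ⟨d, -, hd⟩ := exists_eq_oflipCM_of_wt_eq_one c₁ hc2' hb
      have hnbr : res₁ hcH hcen x b.out = oflipCM c₁ hc2' d (res₀ hcH b.out) := by
        rw [hd, oflipCM_oflipCM_self]
      have hfix : rt c (Q'⁻¹ * Q) b.out = b.out := by rw [rt_mul, h', rt_inv_rt]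
      have hQ := eq_one_of_rt_eq_of_nbr hcH hcen hc2 hH hx hxx hxc hH2 hnbr hfix
      have : Q = Q' := by rw [← mul_left_cancel_iff (a := Q'⁻¹), hQ, inv_mul_cancel]
      subst this
      rfl
    · rintro ⟨Θ, hΘ⟩
      obtain ⟨Q, hQ⟩ := exists_rt_eq_of_blk_eq c (show blk c (blk c Θ).out = blk c Θ from Quotient.out_eq _)
      refine ⟨⟨⟨blk c Θ, by rw [← wt_res_rt hcH hcen hc2 hH hx hxx Q, hQ]; exact hΘ⟩, Q⟩, Subtype.ext hQ⟩
  rw [← Nat.card_congr (Equiv.ofBijective _ hbij), Nat.card_prod, Nat.card_eq_fintype_card, Nat.card_eq_fintype_card]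

/-- **`#{neighbour blocks} · 4 = 2^{|H|/2}`** for the spectator doubling with `|H| ≠ 2` — i.e. `#{neighbour blocks} = 2^{n_H − 2}`, `n_H = |H|/2`
the number of places of `H`. [folklore] -/
theorem card_nbr_blocks_mul_four (hcH : c ∈ H) (hcen : ∀ g : G, g * c = c * g) (hc2 : c * c = 1) (hc1 : c ≠ 1) (hH : H.index = 2)
    {x : G} (hx : x ∉ H) (hxx : x * x = 1) (hxc : ∀ g : G, g * x = x * g) (hH2 : Fintype.card H ≠ 2) :
    Fintype.card {b : Block c // wt (⟨c, hcH⟩ : H) (res₁ hcH hcen x b.out) (res₀ hcH b.out) = 1} * 4 = 2 ^ (Fintype.card H / 2) := by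
  have hc2' := csub_mul_csub hcH hc2
  have h1 := card_nbr_blocks_mul_card hcH hcen hc2 hH hx hxx hxc hH2
  rw [card_nbr_types hcH hcen hc2 hH hx, card_CMF (⟨c, hcH⟩ : H) hc2' (csub_ne_one hcH hc1)] at h1
  -- `|G| = 2 |H| = 4 · (|H|/2)` and `|H|/2 > 0`
  have hG : Fintype.card G = 2 * Nat.card H := by
    rw [← Nat.card_eq_fintype_card, ← hH]; exact (Subgroup.index_mul_card H).symm
  rw [Nat.card_eq_fintype_card] at hG
  have hHpos : 0 < Fintype.card H := Fintype.card_pos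
  have h2 : 2 ∣ Fintype.card H := by
    have hord : orderOf (⟨c, hcH⟩ : H) = 2 := orderOf_eq_prime (by rw [pow_two]; exact hc2') (csub_ne_one hcH hc1)
    rw [← hord]; exact orderOf_dvd_card
  have hpos : 0 < Fintype.card H / 2 := by omega
  have hG4 : Fintype.card G = 4 * (Fintype.card H / 2) := by omega
  rw [hG4] at h1
  -- cancel the positive factor `|H|/2`
  have h2 : Fintype.card {b : Block c // wt (⟨c, hcH⟩ : H) (res₁ hcH hcen x b.out) (res₀ hcH b.out) = 1} * 4 * (Fintype.card H / 2) =
      2 ^ (Fintype.card H / 2) * (Fintype.card H / 2) := by rw [mul_assoc, h1]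
  exact Nat.eq_of_mul_eq_mul_right hpos h2

/-- **THE BLOCK COUNT OF THE SPECTATOR DOUBLING**: `β(G, c) = β(H, c) + #{neighbour blocks} + #{far blocks}` with `#{neighbour blocks} · 4 = 2^{|H|/2}`.
[folklore] -/
theorem card_block_spectator (hcH : c ∈ H) (hcen : ∀ g : G, g * c = c * g) (hc2 : c * c = 1) (hH : H.index = 2) {x : G} (hx : x ∉ H)
    (hxx : x * x = 1) (hxc : ∀ g : G, g * x = x * g) :
    Fintype.card (Block c) = Fintype.card (Block (⟨c, hcH⟩ : H)) +
      (Finset.univ.filter fun b : Block c => wt (⟨c, hcH⟩ : H) (res₁ hcH hcen x b.out) (res₀ hcH b.out) = 1).card +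
      (Finset.univ.filter fun b : Block c => 2 ≤ wt (⟨c, hcH⟩ : H) (res₁ hcH hcen x b.out) (res₀ hcH b.out)).card := by
  classical
  rw [← card_diagonal_blocks hcH hcen hc2 hH hx hxx hxc, Fintype.card_subtype]
  have hsplit : (Finset.univ : Finset (Block c)) =
      (Finset.univ.filter fun b : Block c => wt (⟨c, hcH⟩ : H) (res₁ hcH hcen x b.out) (res₀ hcH b.out) = 0) ∪
      ((Finset.univ.filter fun b : Block c => wt (⟨c, hcH⟩ : H) (res₁ hcH hcen x b.out) (res₀ hcH b.out) = 1) ∪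
       (Finset.univ.filter fun b : Block c => 2 ≤ wt (⟨c, hcH⟩ : H) (res₁ hcH hcen x b.out) (res₀ hcH b.out))) := by
    ext b; simp only [Finset.mem_union, Finset.mem_filter, Finset.mem_univ, true_and, true_iff]; omega
  conv_lhs => rw [← Finset.card_univ, hsplit]
  rw [Finset.card_union_of_disjoint, Finset.card_union_of_disjoint, add_assoc]
  · exact Finset.disjoint_filter.mpr fun _ _ h1 h2 => by omega
  · rw [Finset.disjoint_union_right]
    exact ⟨Finset.disjoint_filter.mpr fun _ _ h1 h2 => by omega, Finset.disjoint_filter.mpr fun _ _ h1 h2 => by omega⟩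

end

end Summit.HodgeConjecture.CorCM.Census.Spectator
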